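import Mathlib
import Literature.Geometry.Kaehler.ComplexTorusOfComplexStructure
import Literature.Analysis.Complex.DbarInequalityLeadingTerm
import HarnessLib

/-!
# The holomorphic leading term of a `J`-holomorphic curve ("tangent space and critical order")

Let `F` be a real normed space of dimension `2n`, `J : F → End_ℝ(F)` a `C¹` almost complex
structure on an open set `U` (`J(x)² = -1`), and `u : B(z₀,R) → U ⊆ F` a smooth map satisfying the
`J`-holomorphic curve equation in a conformal chart of the domain,

  `∂_y u (z) = J(u(z)) ∂ₓ u (z)`      (`∂ₓ = fderiv ℝ u z 1`, `∂_y = fderiv ℝ u z I`),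

which is not locally constant at `z₀`. **`jHolomorphic_leadingTerm`**: in real-linear coordinates
`Φ : F ≃ ℂⁿ` carrying `J(u(z₀))` to `i` (`exists_equiv_euclidean_of_complexStructure`, from the
complex coordinates `Literature.Geometry.Kaehler.CxModule.coordJ` of `(F, J(u(z₀)))`),

  `Φ (u(z₀ + z) - u(z₀)) = z^k • b + R(z)`,  `k ≥ 1`, `b ∈ ℂⁿ ∖ {0}`,
  `‖R(z)‖ ≤ C |z|^{k+1}`, `‖DR(z)‖ ≤ C |z|^k` near `z = 0`.

This is Wendl 2020, App. B, Cor. B.21 with Rem. B.22 for (smooth) `J`-holomorphic curves — the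
nontrivial, holomorphic lowest-order Taylor term — i.e. the "tangent space `L = Φ⁻¹(ℂ b)` and
critical order `k - 1`" with which the local representation formula (Wendl 2020 Thm B.23;
Micallef–White 1995) starts; McDuff–Salamon 2012 §2.3 (via the Carleman similarity principle).
Here it is obtained from the vector-valued theorem for the differential inequality
`‖Dh(1) + iDh(i)‖ ≤ M‖h‖` (`Literature.Analysis.Complex.exists_leadingTerm_bounds`, frequency
function + jets): with `h = Φ(u(z₀ + ·) - u(z₀))` and `J₀ = J(u(z₀))`,
`Dh(1) + i Dh(i) = Φ(∂ₓu + J₀ J(u) ∂ₓu) = Φ J₀ (J(u) - J₀) ∂ₓu` has norm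
`≤ ‖Φ‖‖J₀‖ · K‖u - u(z₀)‖ · sup‖∂ₓu‖ ≤ M ‖h‖` (`J` Lipschitz near `u(z₀)`).

Everything is proved; no named facts.

## References

* C. Wendl, *Lectures on Contact 3-Manifolds, Holomorphic Curves and Intersection Theory*,
  Cambridge Tracts in Math. 220 (2020), App. B, Cor. B.21, Rem. B.22, Thm B.23. [Wendl2020]
* D. McDuff, D. Salamon, *J-holomorphic curves and symplectic topology*, 2nd ed. (2012), §2.3,
  and D. McDuff, J. Differential Geom. 34 (1991), Lemma 2.3. [McDuffSalamon2012]
  [McDuff1991LocalBehaviour]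
* M. Micallef, B. White, Ann. of Math. 141 (1995), Thm 6.1. [MicallefWhite1995]
-/

noncomputable section

open scoped ContDiff Topology
open Set Filter Metric Function Complex

namespace Literature.Geometry.Symplectic

open Literature.Geometry.Kaehler Literature.Analysis.Complex

/-! ### Linear complex coordinates adapted to a complex structure `J₀` -/

/-- **Linear coordinates carrying `J₀` to `i`.** A real `2n`-dimensional normed space with a
complex structure `J₀` (`J₀² = -1`) is real-linearly homeomorphic to `ℂⁿ` (with its Euclidean
norm) by a map `Φ` with `Φ ∘ J₀ = i • Φ`. [folklore] -/
theorem exists_equiv_euclidean_of_complexStructure {F : Type*} [NormedAddCommGroup F]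
    [NormedSpace ℝ F] [FiniteDimensional ℝ F] {n : ℕ} (hn : Module.finrank ℝ F = 2 * n)
    (J₀ : F →L[ℝ] F) (hJ₀ : ∀ v, J₀ (J₀ v) = -v) :
    ∃ Φ : F ≃L[ℝ] EuclideanSpace ℂ (Fin n), ∀ v, Φ (J₀ v) = I • Φ v := by
  have hJJ : (J₀ : F →ₗ[ℝ] F) * (J₀ : F →ₗ[ℝ] F) = -1 := by
    apply LinearMap.ext
    intro v
    simp [hJ₀ v]
  let Φ₀ : F ≃ₗ[ℝ] (Fin n → ℂ) := CxModule.coordJ (J₀ : F →ₗ[ℝ] F) hJJ hn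
  let eC : (Fin n → ℂ) ≃ₗ[ℂ] EuclideanSpace ℂ (Fin n) := (WithLp.linearEquiv 2 ℂ (Fin n → ℂ)).symm
  let e : (Fin n → ℂ) ≃L[ℝ] EuclideanSpace ℂ (Fin n) :=
    (eC.restrictScalars ℝ).toContinuousLinearEquiv
  refine ⟨Φ₀.toContinuousLinearEquiv.trans e, fun v => ?_⟩
  show eC (Φ₀ (J₀ v)) = I • eC (Φ₀ v)
  have h1 : Φ₀ (J₀ v) = I • Φ₀ v := CxModule.coordJ_J (J₀ : F →ₗ[ℝ] F) hJJ hn v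
  rw [h1]
  exact eC.map_smul I (Φ₀ v)

/-! ### The `∂̄`-inequality of a `J`-holomorphic curve in adapted linear coordinates -/

/-- `J₀ ((J - J₀) v) = v + J₀ (J v)` for `J₀² = -1`. [folklore] -/
theorem complexStructure_defect_identity {F : Type*} [NormedAddCommGroup F] [NormedSpace ℝ F]
    (J J₀ : F →L[ℝ] F) (hJ₀ : ∀ v, J₀ (J₀ v) = -v) (v : F) :
    v + J₀ (J v) = J₀ ((J - J₀) v) := by
  rw [show (J - J₀) v = J v - J₀ v from rfl, map_sub, hJ₀]; abel

/-- **Holomorphic leading term of a `J`-holomorphic curve** (Wendl 2020, Cor. B.21 / Rem. B.22 for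
smooth `J`-curves; the "tangent space and critical order" of Thm B.23). Let `F` be a real normed
space of dimension `2n`, `J` a `C¹` almost complex structure on an open `U ⊆ F`, and
`u : B(z₀,R) → U` a smooth map with `∂_y u = J(u) ∂ₓ u` which is not locally constant at `z₀`.
Then in linear coordinates `Φ : F ≃ ℂⁿ` with `Φ J(u(z₀)) = iΦ` one has
`Φ(u(z₀ + z) - u(z₀)) = z^k • b + R(z)` with `k ≥ 1`, `b ≠ 0`, `‖R(z)‖ ≤ C|z|^{k+1}` and
`‖DR(z)‖ ≤ C|z|^k` near `0`. [cite: Wendl2020, App. B, Cor. B.21, Rem. B.22, Thm B.23] -/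
theorem jHolomorphic_leadingTerm {F : Type*} [NormedAddCommGroup F] [NormedSpace ℝ F]
    [FiniteDimensional ℝ F] {n : ℕ} (hn : Module.finrank ℝ F = 2 * n)
    {J : F → F →L[ℝ] F} {U : Set F} (hU : IsOpen U) (hJ : ContDiffOn ℝ 1 J U)
    (hJ2 : ∀ x ∈ U, ∀ v, J x (J x v) = -v)
    {u : ℂ → F} {z₀ : ℂ} {R : ℝ} (hR : 0 < R) (hu : ContDiffOn ℝ ∞ u (ball z₀ R))
    (huU : MapsTo u (ball z₀ R) U)
    (hhol : ∀ z ∈ ball z₀ R, fderiv ℝ u z I = J (u z) (fderiv ℝ u z 1))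
    (hnc : ∃ᶠ z in 𝓝 z₀, u z ≠ u z₀) :
    ∃ (k : ℕ) (Φ : F ≃L[ℝ] EuclideanSpace ℂ (Fin n)) (b : EuclideanSpace ℂ (Fin n)) (C ρ : ℝ),
      0 < k ∧ b ≠ 0 ∧ 0 < ρ ∧ ρ ≤ R ∧ (∀ v, Φ (J (u z₀) v) = I • Φ v) ∧
      (∀ z ∈ ball (0 : ℂ) ρ, ‖Φ (u (z₀ + z) - u z₀) - z ^ k • b‖ ≤ C * ‖z‖ ^ (k + 1)) ∧
      (∀ z ∈ ball (0 : ℂ) ρ,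
        ‖fderiv ℝ (fun z => Φ (u (z₀ + z) - u z₀) - z ^ k • b) z‖ ≤ C * ‖z‖ ^ k) := by
  set p : F := u z₀ with hp
  have hpU : p ∈ U := huU (mem_ball_self hR)
  set J₀ : F →L[ℝ] F := J p with hJ₀
  have hJ₀2 : ∀ v, J₀ (J₀ v) = -v := hJ2 p hpU
  obtain ⟨Φ, hΦJ⟩ := exists_equiv_euclidean_of_complexStructure hn J₀ hJ₀2
  -- the map in coordinates
  set h : ℂ → EuclideanSpace ℂ (Fin n) := fun z => Φ (u (z₀ + z) - p) with hh_def
  have hball : ∀ {r : ℝ} {z : ℂ}, z ∈ ball (0 : ℂ) r → z₀ + z ∈ ball z₀ r := by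
    intro r z hz
    simpa [mem_ball, dist_eq_norm] using hz
  have hh : ContDiffOn ℝ ∞ h (ball (0 : ℂ) R) := by
    have h1 : ContDiffOn ℝ ∞ (fun z : ℂ => u (z₀ + z)) (ball (0 : ℂ) R) :=
      hu.comp (contDiff_const.add contDiff_id).contDiffOn fun z hz => hball hz
    exact Φ.contDiff.comp_contDiffOn (h1.sub contDiffOn_const)
  have hfd : ∀ z w : ℂ, fderiv ℝ h z w = Φ (fderiv ℝ u (z₀ + z) w) := by
    intro z w
    have : h = Φ ∘ fun z => u (z₀ + z) - p := rfl
    rw [this, Φ.comp_fderiv, ContinuousLinearMap.comp_apply, fderiv_sub_const,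
      fderiv_comp_add_left]
    rfl
  -- Lipschitz bound for `J` near `p`
  obtain ⟨K, t, ht, hK⟩ := (hJ.contDiffAt (hU.mem_nhds hpU)).exists_lipschitzOnWith
  obtain ⟨δ₁, hδ₁, hδ₁t⟩ := Metric.mem_nhds_iff.1 ht
  -- bound for `Du` near `z₀`
  have hcont : ContinuousOn (fderiv ℝ u) (ball z₀ R) :=
    hu.continuousOn_fderiv_of_isOpen isOpen_ball (by norm_cast)
  obtain ⟨δ₂, hδ₂, hδ₂b⟩ := Metric.continuousAt_iff.1
    (hcont.continuousAt (ball_mem_nhds z₀ hR)) 1 one_pos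
  set B : ℝ := ‖fderiv ℝ u z₀‖ + 1 with hB
  -- `u` stays in the Lipschitz ball
  obtain ⟨δ₃, hδ₃, hδ₃b⟩ := Metric.continuousAt_iff.1
    ((hu.continuousOn.continuousAt (ball_mem_nhds z₀ hR))) δ₁ hδ₁
  set ρ : ℝ := min R (min δ₂ δ₃) with hρ_def
  have hρ : 0 < ρ := lt_min hR (lt_min hδ₂ hδ₃)
  have hρR : ρ ≤ R := min_le_left _ _
  have hρ₂ : ρ ≤ δ₂ := (min_le_right _ _).trans (min_le_left _ _)
  have hρ₃ : ρ ≤ δ₃ := (min_le_right _ _).trans (min_le_right _ _)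
  -- the constant
  set M : ℝ := ‖(Φ : F →L[ℝ] EuclideanSpace ℂ (Fin n))‖ * ‖J₀‖ * K * B *
    ‖(Φ.symm : EuclideanSpace ℂ (Fin n) →L[ℝ] F)‖ with hM_def
  have hM : ∀ z ∈ ball (0 : ℂ) ρ, ‖fderiv ℝ h z 1 + I • fderiv ℝ h z I‖ ≤ M * ‖h z‖ := by
    intro z hz
    set z' : ℂ := z₀ + z with hz'
    have hz'R : z' ∈ ball z₀ R := hball (ball_subset_ball hρR hz)
    have hdz : dist z' z₀ < ρ := by simpa [hz', dist_eq_norm] using hz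
    set v : F := fderiv ℝ u z' 1 with hv
    -- the defect in coordinates
    have hdef : fderiv ℝ h z 1 + I • fderiv ℝ h z I = Φ (J₀ ((J (u z') - J₀) v)) := by
      rw [hfd, hfd, hhol z' hz'R, ← hΦJ, ← map_add, ← hv,
        complexStructure_defect_identity (J (u z')) J₀ hJ₀2 v]
    -- the three bounds
    have hJdiff : ‖J (u z') - J₀‖ ≤ K * ‖u z' - p‖ := by
      have hu' : u z' ∈ t := hδ₁t (hδ₃b (hdz.trans_le hρ₃))
      have hp' : p ∈ t := mem_of_mem_nhds ht
      have := hK.dist_le_mul (u z') hu' p hp'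
      rwa [dist_eq_norm, dist_eq_norm] at this
    have hvB : ‖v‖ ≤ B := by
      have h1 : dist (fderiv ℝ u z') (fderiv ℝ u z₀) < 1 := hδ₂b (hdz.trans_le hρ₂)
      rw [dist_eq_norm] at h1
      calc ‖v‖ ≤ ‖fderiv ℝ u z'‖ * ‖(1 : ℂ)‖ := (fderiv ℝ u z').le_opNorm 1
        _ = ‖fderiv ℝ u z'‖ := by simp
        _ = ‖(fderiv ℝ u z' - fderiv ℝ u z₀) + fderiv ℝ u z₀‖ := by rw [sub_add_cancel]
        _ ≤ ‖fderiv ℝ u z' - fderiv ℝ u z₀‖ + ‖fderiv ℝ u z₀‖ := norm_add_le _ _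
        _ ≤ B := by rw [hB]; linarith
    have hup : ‖u z' - p‖ ≤ ‖(Φ.symm : EuclideanSpace ℂ (Fin n) →L[ℝ] F)‖ * ‖h z‖ := by
      have : u z' - p = Φ.symm (h z) := by simp [hh_def, hz']
      rw [this]
      exact (Φ.symm : EuclideanSpace ℂ (Fin n) →L[ℝ] F).le_opNorm (h z)
    rw [hdef]
    have hK0 : (0 : ℝ) ≤ K := K.2
    calc ‖Φ (J₀ ((J (u z') - J₀) v))‖
        ≤ ‖(Φ : F →L[ℝ] EuclideanSpace ℂ (Fin n))‖ * ‖J₀ ((J (u z') - J₀) v)‖ :=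
          (Φ : F →L[ℝ] EuclideanSpace ℂ (Fin n)).le_opNorm _
      _ ≤ ‖(Φ : F →L[ℝ] EuclideanSpace ℂ (Fin n))‖ * (‖J₀‖ * (‖J (u z') - J₀‖ * ‖v‖)) := by
          gcongr
          exact (J₀.le_opNorm _).trans (mul_le_mul_of_nonneg_left ((J (u z') - J₀).le_opNorm v)
            (norm_nonneg _))
      _ ≤ ‖(Φ : F →L[ℝ] EuclideanSpace ℂ (Fin n))‖ * (‖J₀‖ * (K * ‖u z' - p‖ * B)) := by
          gcongr
      _ ≤ ‖(Φ : F →L[ℝ] EuclideanSpace ℂ (Fin n))‖ *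
            (‖J₀‖ * (K * (‖(Φ.symm : EuclideanSpace ℂ (Fin n) →L[ℝ] F)‖ * ‖h z‖) * B)) := by
          gcongr
      _ = M * ‖h z‖ := by rw [hM_def]; ring
  -- `h 0 = 0` and `h ≢ 0`
  have h0 : h 0 = 0 := by simp [hh_def, hp]
  have hne : ∃ z ∈ ball (0 : ℂ) ρ, h z ≠ 0 := by
    obtain ⟨z, hzne, hzb⟩ := (hnc.and_eventually (ball_mem_nhds z₀ hρ)).exists
    refine ⟨z - z₀, by simpa [mem_ball, dist_eq_norm] using hzb, ?_⟩
    have : h (z - z₀) = Φ (u z - p) := by simp [hh_def]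
    rw [this]
    exact fun h0' => hzne (sub_eq_zero.1 (Φ.map_eq_zero_iff.1 h0'))
  obtain ⟨k, b, C, ρ', hk, hb, hρ', hρ'ρ, hb1, hb2⟩ :=
    exists_leadingTerm_bounds hρ (hh.mono (ball_subset_ball hρR)) hM h0 hne
  exact ⟨k, Φ, b, C, ρ', hk, hb, hρ', hρ'ρ.trans hρR, hΦJ, hb1, hb2⟩

end Literature.Geometry.Symplectic

end
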